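import Summits.Ventures.PercRepro.S2TelescopeCount
import Summits.Ventures.PercRepro.RankLevelSetDepCountHeavyCap

/-!
# PercRepro — S2: THE TELESCOPING COUNT WITH THE LEVEL-`q` TERM KEPT AS THE INDEPENDENT `q`-SETS (p8, gen 21; a feeder for
S4 — the top of the `q = 7` window, the row `43`)

`ncard_eRk_eq_ncard_le_le_tel` (S2TelescopeCount, p8 g20) bounds the level-`q` sets by ALL `q`-subsets, `C(n, q)`. Here the
same proof keeps them as the independent `q`-sets `#{B ⊆ E : r(B) = q, |B| = q}` — so that the `q`-sets containing a triangle
(dependent) can be subtracted (S1IndepSevenCount's Bonferroni count): **`ncard_eRk_eq_ncard_le_le_tel7`**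
`#{B ⊆ E : r(B) = q, |B| ≤ d} ≤ #{B : r(B) = q, |B| = q} + Σ_{j < d − q} Λ(j + 1) + 2^{min f (q + d)}`, `Λ = lamTel (C(n, q)) P′ F ρ`.
Everything else — the hypotheses, the telescoping, the giant term — is verbatim. Axioms: standard.
-/

open scoped Matroid

namespace PercRepro

namespace S2

open Set Finset

variable {α : Type} {M : Matroid α}

open scoped Classical in
/-- **THE TELESCOPING COUNT** (in `ℚ`): with every circuit of `≥ 3` elements, every rank-`2` set of `≤ 3` points, every
rank-`≤ 3` set of `≤ 6` points, every set of rank `≤ q` of `≤ f` points, every set of rank `≤ q − 1` of `≤ f′` points and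
of nullity `≤ ν_∩`, `|E| = r(M) + d`, `d + ν_∩ < 2ν₁`, `f′ − q ≤ min(f − q − 1, ν₁ − 2)`, and every level-`m` set with at
least `ρ(m − q) ≥ 1` non-coloops:
`#{B ⊆ E : r(B) = q, |B| ≤ d} ≤ C(n, q) + Σ_{j < d − q} Λ(j + 1) + 2^{min f (q + d)}`, `Λ = lamTel (C(n, q)) P′ F ρ`,
`P′ = Σ_k s_k·C(n − k, q + 1 − k)`, `F = min(f − q − 1, ν₁ − 2)`. -/
theorem ncard_eRk_eq_ncard_le_le_tel7 (M : Matroid α) [M.Finite] (q f f' ν₁ νi : ℕ) (ρ : ℕ → ℕ) (hq : 1 ≤ q)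
    (hcirc : ∀ C, M.IsCircuit C → 3 ≤ C.encard) (hC1 : ∀ L ⊆ M.E, M.eRk L = 2 → L.ncard ≤ 3)
    (hC2 : ∀ L ⊆ M.E, M.eRk L ≤ 3 → L.ncard ≤ 6)
    (hflat : ∀ X ⊆ M.E, M.eRk X ≤ q → X.ncard ≤ f)
    (hflat' : ∀ X ⊆ M.E, M.eRk X ≤ (q - 1 : ℕ) → X.ncard ≤ f')
    (hinter : ∀ X ⊆ M.E, M.eRk X ≤ (q - 1 : ℕ) → (X.ncard : ℕ∞) ≤ M.eRk X + νi)
    {d : ℕ} (hd : M.E.encard = M.eRank + d) (h2 : d + νi < 2 * ν₁)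
    (hσm : f' - q ≤ min (f - (q + 1)) (ν₁ - 2))
    (hρ : ∀ ν, 1 ≤ ρ (ν + 1))
    (hcol : ∀ m, q + 1 ≤ m → m ≤ d → ∀ B ∈ Matroid.levelF M q m, ρ (m - q) ≤ (nonColoops M q B).card) :
    ({B : Set α | B ⊆ M.E ∧ M.eRk B = q ∧ B.ncard ≤ d}.ncard : ℚ) ≤
      ({B : Set α | B ⊆ M.E ∧ M.eRk B = q ∧ B.ncard = q}.ncard : ℚ) +
        (∑ j ∈ Finset.range (d - q), lamTel (M.E.ncard.choose q : ℚ)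
          (∑ k ∈ Finset.Icc 3 (q + 1),
            ({C | M.IsCircuit C ∧ C.ncard = k}.ncard : ℚ) * ((M.E.ncard - k).choose (q + 1 - k) : ℚ))
          (min (f - (q + 1)) (ν₁ - 2)) ρ (j + 1)) +
        (2 : ℚ) ^ (min f (q + d)) := by
  set Ef := Matroid.groundF M with hEf
  have hE : (Ef : Set α) = M.E := Matroid.coe_groundF M
  have hEcard : Ef.card = M.E.ncard := Matroid.card_groundF M
  set F := min (f - (q + 1)) (ν₁ - 2) with hF
  set P : ℚ := ∑ k ∈ Finset.Icc 3 (q + 1),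
    ({C | M.IsCircuit C ∧ C.ncard = k}.ncard : ℚ) * ((M.E.ncard - k).choose (q + 1 - k) : ℚ) with hPdef
  set c : ℚ := (M.E.ncard.choose q : ℚ) with hc
  set S := {B : Set α | B ⊆ M.E ∧ M.eRk B = q ∧ B.ncard ≤ d} with hS
  set S₁ := {B : Set α | B ⊆ M.E ∧ M.eRk B = q ∧ B.ncard = q} with hS₁
  set S₂ := {B : Set α | B ⊆ M.E ∧ M.eRk B = q ∧ q < B.ncard ∧ B.ncard ≤ d} with hS₂
  have hsplit : S ⊆ S₁ ∪ S₂ := by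
    intro B hB
    have hBfin : B.Finite := M.ground_finite.subset hB.1
    have hle : q ≤ B.ncard := by
      have := M.eRk_le_encard B
      rw [hB.2.1, ← hBfin.cast_ncard_eq] at this
      exact_mod_cast this
    rcases hle.lt_or_eq with h | h
    · exact Or.inr ⟨hB.1, hB.2.1, h, hB.2.2⟩
    · exact Or.inl ⟨hB.1, hB.2.1, h.symm⟩
  have hS₁fin : S₁.Finite := M.ground_finite.finite_subsets.subset (fun B hB => hB.1)
  have hS₂fin : S₂.Finite := M.ground_finite.finite_subsets.subset (fun B hB => hB.1)
  -- the pair count: `#pairsF ≤ P′`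
  have hP0 : (0 : ℚ) ≤ P := Finset.sum_nonneg (fun k _ => by positivity)
  have hpairs : ((Matroid.pairsF M q).card : ℚ) ≤ P := by
    have h := Matroid.card_pairsF_le_disj (M := M) q
    have : (((Matroid.pairsF M q).card : ℕ) : ℚ) ≤ ((∑ k ∈ Finset.Icc 3 (q + 1),
        {C | M.IsCircuit C ∧ C.ncard = k}.ncard * (M.E.ncard - k).choose (q + 1 - k) : ℕ) : ℚ) := by
      exact_mod_cast h
    push_cast at this
    exact this
  have hPsPm : (Matroid.pairsSmall M q f').card + (Matroid.pairsMid M q f' ν₁).card ≤ (Matroid.pairsF M q).card := by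
    have h1 : (Matroid.pairsSmall M q f').card + (Matroid.pairsBig M q f').card = (Matroid.pairsF M q).card := by
      unfold Matroid.pairsSmall Matroid.pairsBig
      exact Finset.card_filter_add_card_filter_not _
    have h2 : (Matroid.pairsMid M q f' ν₁).card ≤ (Matroid.pairsBig M q f').card := by
      unfold Matroid.pairsMid
      exact Finset.card_filter_le _ _
    omega
  -- the per-level bound on the non-giant sets
  have hNG : ∀ ν : ℕ, q + ν ≤ d → ((levelFNonGiant M q f' ν₁ (q + ν)).card : ℚ) ≤ lamTel c P F ρ ν := by
    intro ν
    induction ν with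
    | zero =>
      intro _
      rw [lamTel_zero, hc, add_zero]
      have hsub : levelFNonGiant M q f' ν₁ q ⊆ Ef.powersetCard q := by
        intro B hB
        rw [levelFNonGiant, Finset.mem_filter, Matroid.levelF, Finset.mem_filter] at hB
        exact hB.1.1
      have := Finset.card_le_card hsub
      rw [Finset.card_powersetCard, hEcard] at this
      exact_mod_cast this
    | succ ν ih =>
      intro hν
      have ih' := ih (by omega)
      rw [lamTel_succ]
      refine le_min ?_ ?_
      · -- the pair count at level `q + ν + 1`
        have h := mul_card_levelFNonGiant_le q f f' ν₁ hq hcirc hC1 hC2 hflat (q + ν + 1)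
        rw [show q + ν + 1 - q = ν + 1 by omega, show q + ν + 1 - (q + 1) = ν by omega] at h
        have hmono : (f' - q).choose ν ≤ F.choose ν := Nat.choose_le_choose ν hσm
        have h' : ((ν + 1) + 3 * (ν + 1).choose 2 + 3 * (ν + 1).choose 3 + 2 * (ν + 1).choose 4) *
            (levelFNonGiant M q f' ν₁ (q + ν + 1)).card ≤ (Matroid.pairsF M q).card * F.choose ν := by
          calc ((ν + 1) + 3 * (ν + 1).choose 2 + 3 * (ν + 1).choose 3 + 2 * (ν + 1).choose 4) *
                (levelFNonGiant M q f' ν₁ (q + ν + 1)).card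
              ≤ (Matroid.pairsSmall M q f').card * (f' - q).choose ν +
                  (Matroid.pairsMid M q f' ν₁).card * F.choose ν := h
            _ ≤ (Matroid.pairsSmall M q f').card * F.choose ν +
                  (Matroid.pairsMid M q f' ν₁).card * F.choose ν := by
                gcongr
            _ = ((Matroid.pairsSmall M q f').card + (Matroid.pairsMid M q f' ν₁).card) * F.choose ν := by ring
            _ ≤ (Matroid.pairsF M q).card * F.choose ν := Nat.mul_le_mul_right _ hPsPm
        have hpos : (0 : ℚ) < (((ν + 1) + 3 * (ν + 1).choose 2 + 3 * (ν + 1).choose 3 + 2 * (ν + 1).choose 4 : ℕ) : ℚ) := by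
          exact_mod_cast (by omega : 0 < (ν + 1) + 3 * (ν + 1).choose 2 + 3 * (ν + 1).choose 3 + 2 * (ν + 1).choose 4)
        rw [le_div_iff₀ hpos]
        have hq' : ((((ν + 1) + 3 * (ν + 1).choose 2 + 3 * (ν + 1).choose 3 + 2 * (ν + 1).choose 4) *
            (levelFNonGiant M q f' ν₁ (q + ν + 1)).card : ℕ) : ℚ) ≤
            (((Matroid.pairsF M q).card * F.choose ν : ℕ) : ℚ) := by exact_mod_cast h'
        push_cast at hq'
        have hF0 : (0 : ℚ) ≤ ((F.choose ν : ℕ) : ℚ) := Nat.cast_nonneg _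
        calc ((levelFNonGiant M q f' ν₁ (q + ν + 1)).card : ℚ) *
              (((ν + 1) + 3 * (ν + 1).choose 2 + 3 * (ν + 1).choose 3 + 2 * (ν + 1).choose 4 : ℕ) : ℚ)
            = (((ν + 1) + 3 * (ν + 1).choose 2 + 3 * (ν + 1).choose 3 + 2 * (ν + 1).choose 4 : ℕ) : ℚ) *
              ((levelFNonGiant M q f' ν₁ (q + ν + 1)).card : ℚ) := by ring
          _ ≤ ((Matroid.pairsF M q).card : ℚ) * ((F.choose ν : ℕ) : ℚ) := by push_cast at hq' ⊢; exact hq'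
          _ ≤ P * ((F.choose ν : ℕ) : ℚ) := mul_le_mul_of_nonneg_right hpairs hF0
      · -- the telescoping step at level `q + ν + 1`
        have hcap : ∀ T ∈ levelFNonGiant M q f' ν₁ (q + ν + 1 - 1), (M.closure (T : Set α)).ncard ≤ F + q + 1 :=
          fun T hT => ncard_closure_le_of_mem_levelFNonGiant q f f' ν₁ _ hflat hσm hT
        have hcol' : ∀ B ∈ levelFNonGiant M q f' ν₁ (q + ν + 1), ρ (ν + 1) ≤ (nonColoops M q B).card := by
          intro B hB
          rw [levelFNonGiant, Finset.mem_filter] at hB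
          have := hcol (q + ν + 1) (by omega) hν B hB.1
          rwa [show q + ν + 1 - q = ν + 1 by omega] at this
        have h := mul_card_levelFNonGiant_le_of_nonColoops q f' ν₁ (q + ν + 1) (F + q + 1) (ρ (ν + 1)) hcap hcol'
        rw [show q + ν + 1 - 1 = q + ν by omega, show F + q + 1 + 1 - (q + ν + 1) = F + 1 - ν by omega] at h
        have hρpos : (0 : ℚ) < ((ρ (ν + 1) : ℕ) : ℚ) := by exact_mod_cast hρ ν
        have hq' : ((ρ (ν + 1) * (levelFNonGiant M q f' ν₁ (q + ν + 1)).card : ℕ) : ℚ) ≤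
            (((F + 1 - ν) * (levelFNonGiant M q f' ν₁ (q + ν)).card : ℕ) : ℚ) := by exact_mod_cast h
        push_cast at hq'
        rw [mul_div_assoc', le_div_iff₀ hρpos]
        have hF0 : (0 : ℚ) ≤ (((F + 1 - ν : ℕ)) : ℚ) := Nat.cast_nonneg _
        calc ((levelFNonGiant M q f' ν₁ (q + ν + 1)).card : ℚ) * ((ρ (ν + 1) : ℕ) : ℚ)
            = ((ρ (ν + 1) : ℕ) : ℚ) * ((levelFNonGiant M q f' ν₁ (q + ν + 1)).card : ℚ) := by ring
          _ ≤ (((F + 1 - ν : ℕ)) : ℚ) * ((levelFNonGiant M q f' ν₁ (q + ν)).card : ℚ) := hq'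
          _ ≤ (((F + 1 - ν : ℕ)) : ℚ) * lamTel c P F ρ ν := mul_le_mul_of_nonneg_left ih' hF0
          _ = lamTel c P F ρ ν * (((F + 1 - ν : ℕ)) : ℚ) := by ring
  -- the giant levels
  have hgiant : ((∑ m ∈ Finset.Icc (q + 1) d, (levelFGiant M q f' ν₁ m).card : ℕ) : ℚ) ≤ (2 : ℚ) ^ (min f (q + d)) := by
    have := sum_card_levelFGiant_le q f f' ν₁ νi hq hcirc hC1 hC2 hflat hflat' hinter hd h2
    exact_mod_cast this
  -- the dependent sets, level by level
  have hS₂q : (S₂.ncard : ℚ) ≤ ∑ m ∈ Finset.Icc (q + 1) d, lamTel c P F ρ (m - q) + (2 : ℚ) ^ (min f (q + d)) := by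
    calc (S₂.ncard : ℚ) ≤ ((∑ m ∈ Finset.Icc (q + 1) d, (Matroid.levelF M q m).card : ℕ) : ℚ) := by
          exact_mod_cast Matroid.ncard_dep_le_sum_levelF q d
      _ = ((∑ m ∈ Finset.Icc (q + 1) d, (levelFNonGiant M q f' ν₁ m).card : ℕ) : ℚ) +
          ((∑ m ∈ Finset.Icc (q + 1) d, (levelFGiant M q f' ν₁ m).card : ℕ) : ℚ) := by
          rw [← Nat.cast_add, ← Finset.sum_add_distrib]
          congr 1
          exact Finset.sum_congr rfl (fun m _ => card_levelF_eq_nonGiant_add_giant q f' ν₁ m)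
      _ ≤ ∑ m ∈ Finset.Icc (q + 1) d, ((levelFNonGiant M q f' ν₁ m).card : ℚ) + (2 : ℚ) ^ (min f (q + d)) := by
          push_cast at hgiant ⊢
          exact add_le_add le_rfl hgiant
      _ ≤ _ := by
          refine add_le_add (Finset.sum_le_sum ?_) le_rfl
          intro m hm
          rw [Finset.mem_Icc] at hm
          have := hNG (m - q) (by omega)
          rwa [show q + (m - q) = m by omega] at this
  have hre : ∑ m ∈ Finset.Icc (q + 1) d, lamTel c P F ρ (m - q) =
      ∑ j ∈ Finset.range (d - q), lamTel c P F ρ (j + 1) := by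
    rw [show Finset.Icc (q + 1) d = Finset.image (fun j => q + 1 + j) (Finset.range (d - q)) from ?_]
    · rw [Finset.sum_image (fun a _ b _ h => by omega)]
      apply Finset.sum_congr rfl
      intro j _
      rw [show q + 1 + j - q = j + 1 by omega]
    · ext m
      rw [Finset.mem_Icc, Finset.mem_image]
      constructor
      · intro hm
        exact ⟨m - (q + 1), by rw [Finset.mem_range]; omega, by omega⟩
      · rintro ⟨j, hj, rfl⟩
        rw [Finset.mem_range] at hj
        omega
  have hSq : (S.ncard : ℚ) ≤ (S₁.ncard : ℚ) + (S₂.ncard : ℚ) := by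
    have : S.ncard ≤ S₁.ncard + S₂.ncard :=
      (ncard_le_ncard hsplit (hS₁fin.union hS₂fin)).trans (ncard_union_le _ _)
    exact_mod_cast this
  rw [hre] at hS₂q
  calc (S.ncard : ℚ) ≤ (S₁.ncard : ℚ) + (S₂.ncard : ℚ) := hSq
    _ ≤ _ := by linarith only [hS₂q]

end S2

end PercRepro
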